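import Literature.MathematicalPhysics.QuantumFieldTheory.BalabanImbrieJaffe1984to88.BIJ88TruncatedExpectation5142

/-!
# `BalabanImbrieJaffe1984to88.BIJ88TruncatedExpectation5142Slots` — [BalabanImbrieJaffe1988] CMP **114** (1988), Sect. 5.14 p. 308 / p. 310:
**«We express each d/dt as a sum Σ_γ (d/dt)_γ»** — the ASSIGNMENT-SUMMED form of the sibling `BIJ88TruncatedExpectation5142`: for slot-local
moments and their slot-local display-2 truncations, `Σ_γ ⟨(d/dt)_{γ_1}; …; (d/dt)_{γ_n}⟩_t = (d/dt)ⁿ log z_t`.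

statement-level skeleton of published theorems with citation tags; proofs where landed; nothing here is a claim about the Yang–Mills mass gap

THE PRINT (verbatim, p. 308 [PDF 52], image `lit-balaban-r16/renders/cmp114/original-p052-x2.png`): *"We express each d/dt as a sum Σ_γ (d/dt)_γ,
where (d/dt)_γ acts only on the t before a particular term V^{(k)}(Y) in Ṽ^{(k)} or in a particular χ-factor. We cluster expand as before each
integral making up the truncated expectation values ⟨(d/dt)_{γ_1}; …; (d/dt)_{γ_{n̄+1}}⟩_t."*  p. 310 [PDF 54] display 2 (image
`renders/original-p054-x2.png` of the p36 seat): *"⟨Π_{j∈H}(d/dt)_{γ_j}⟩_t = Σ_{{H_τ}∈𝒫(H)} Π_τ ⟨Π_{j∈H_τ}[;(d/dt)_{γ_j}]⟩_t."*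

THE POINT.  In (5.14.2) the `n̄+1` copies of `d/dt` are split over the slots `γ_j` (the `t`-carrying factors) and the truncated
expectations are taken PER ASSIGNMENT `γ = (γ_1, …, γ_{n̄+1})`, display 2 holding for each `γ`; the moments `⟨Π_{j∈K}(d/dt)_{γ_j}⟩_t`
and their truncations depend on `γ` only through `γ|_K` (slot-locality; p25's `BIJ88Expansion5143.IsSlotLocal` corner data are of this
kind) and the assignment sum of the moments is the derivative moment `⟨(d/dt)^{|K|}⟩_t = z_t^{(|K|)}/z_t` (Leibniz).  Then — by the
PRODUCT STRUCTURE of the assignments over the blocks of a set partition — the assignment-summed truncations solve display 2 for the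
derivative moments, hence (sibling file) equal the log-derivatives.

WHAT IS PROVED (definitions with bodies `asg`, `pin`; theorems; no `Prop` fact).
* `asg s₀ K` — the assignments of the labels of `K` (functions on all labels, pinned to a base slot `s₀` off `K`; `asg s₀ univ = univ`,
  `asg s₀ ∅ = {const}`); `pin s₀ A γ`.
* **`sum_asg_union_mul`** — product structure over two disjoint label sets: `Σ_{γ∈asg(A∪C)} u(γ)w(γ) = (Σ_{asg A} u)(Σ_{asg C} w)` for
  `u` local on `A`, `w` local on `C` (explicit bijection `γ ↦ (pin_A γ, pin_C γ)`).
* **`sum_asg_prod_eq_prod_sum`** — for a set partition `π` of `K` and block-local factors: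
  `Σ_{γ∈asg K} Π_{B∈π} g(B,γ) = Π_{B∈π} Σ_{γ∈asg B} g(B,γ)` (induction on the blocks).
* **`sum_asg_trunc_rel`** — slot-local display-2 truncations `κ(B,γ)` of slot moments `N(K,γ)`: the sums `Σ_{γ∈asg K} N(K,γ)` and
  `Σ_{γ∈asg B} κ(B,γ)` again satisfy display 2 (multilinearity of truncation).
* **`sum_asg_trunc_eq_iteratedDerivWithin_log`**, **`sum_trunc_univ_eq_iteratedDerivWithin_log`** — if the slot moments sum to
  `z^{(|K|)}(t)/z(t)` (`z > 0` of class `Cⁿ` within `s ∋ t`), then `Σ_{γ} κ(K,γ) = (log z)^{(|K|)}(t)`; for all `n` labels and all assignments: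
  `Σ_{γ : H → slots} ⟨(d/dt)_{γ_1}; …; (d/dt)_{γ_n}⟩_t = (d/dt)ⁿ log z_t`.
* **`remR_sum_trunc_eq`** — on `[0,1]` with r16's `remR` BY NAME: the printed `ℛ_k` of the assignment-summed truncated expectation
  `= −(1/(n̄+1)) ∫₀¹ ((1−t)^{n̄}/n̄!) (d/dt)^{n̄+1} log z_t dt` (the sibling's `remR_trunc_eq`; GAPS G-C2-p36-06).

HONEST SCOPE.  The slot moments `N` and truncations `κ` are abstract data subject to DISPLAYED hypotheses (locality; display 2 per assignment;
Leibniz sum = derivative moment); the Leibniz identity for the concrete integrand and the cluster expansion of each `⟨(d/dt)_{γ_1};…⟩_t`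
((5.14.3), p25's `BIJ88Expansion5143*`) are NOT re-derived or asserted here.  0 `sorry`; axioms standard.

CITATION HEADER (lean-in-tree rule).  lit-balaban TYPED SKELETON (HOME `run/shared/lean/pub/lit-balaban/`), Phase 2, seat p36 gen 9
(unit `lit-balaban-p36`); rows **C2.Eq5.14.1-5.14.2** (member (5.14.2)) and **C2.Claim@310** (display 2) of `HOME/lit-balaban-r16/ROWS-C2-part2.md`
(owner r16; heads untouched).  PDF held: `paper:balaban1988-cmp114-bij-abelian-higgs-effective-action` (journal page = PDF page + 256).
NOT summit progress.
-/

open Finset MeasureTheory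
open Literature.Probability.LatticeModels (IsSetPartition setPartitions mem_setPartitions)
open Literature.MathematicalPhysics.QuantumFieldTheory.BalabanImbrieJaffe1984to88.BIJ88Sect5StatementsPart4 (remR)

namespace Literature.MathematicalPhysics.QuantumFieldTheory.BalabanImbrieJaffe1984to88.BIJ88TruncatedExpectation5142

section Slots

variable {α : Type*} [Fintype α] [DecidableEq α] {S : Type*} [Fintype S] {R : Type*} [CommRing R]

/-- The assignments `γ` of the derivative labels in `K` to slots (*"(d/dt)_γ acts only on the t before a particular term V^{(k)}(Y) in Ṽ^{(k)}
or in a particular χ-factor"*), as functions on all labels pinned to a base slot `s₀` off `K`. [cite: BalabanImbrieJaffe1988, (5.14.2) p.308] -/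
def asg (s₀ : S) (K : Finset α) : Finset (α → S) :=
  Fintype.piFinset fun j => if j ∈ K then univ else {s₀}

/-- Membership in `asg`: free on `K`, pinned to `s₀` off `K`. [cite: BalabanImbrieJaffe1988, (5.14.2) p.308] -/
theorem mem_asg {s₀ : S} {K : Finset α} {γ : α → S} : γ ∈ asg s₀ K ↔ ∀ j, j ∉ K → γ j = s₀ := by
  simp only [asg, Fintype.mem_piFinset]
  refine ⟨fun h j hj => ?_, fun h j => ?_⟩
  · simpa [hj] using h j
  · by_cases hj : j ∈ K
    · simp [hj]
    · simp [hj, h j hj]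

/-- All labels free: `asg s₀ univ` is the set of all assignments. [cite: BalabanImbrieJaffe1988, (5.14.2) p.308] -/
theorem asg_univ (s₀ : S) : asg s₀ (univ : Finset α) = univ := by
  ext γ; simp [mem_asg]

/-- No label free: `asg s₀ ∅ = {const s₀}`. [cite: BalabanImbrieJaffe1988, (5.14.2) p.308] -/
theorem asg_empty (s₀ : S) : asg s₀ (∅ : Finset α) = {fun _ => s₀} := by
  ext γ
  simp only [mem_asg, notMem_empty, not_false_eq_true, forall_const, mem_singleton]
  exact ⟨fun h => funext h, fun h j => by rw [h]⟩

/-- Pinning an assignment to `A`: keep it on `A`, base slot elsewhere. [cite: BalabanImbrieJaffe1988, (5.14.2) p.308] -/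
def pin (s₀ : S) (A : Finset α) (γ : α → S) : α → S := fun j => if j ∈ A then γ j else s₀

omit [Fintype α] [Fintype S] in
/-- `pin` agrees with `γ` on `A`. [cite: BalabanImbrieJaffe1988, (5.14.2) p.308] -/
theorem pin_apply_of_mem {s₀ : S} {A : Finset α} {γ : α → S} {j : α} (hj : j ∈ A) : pin s₀ A γ j = γ j := by
  simp [pin, hj]

/-- `pin s₀ A γ ∈ asg s₀ A`. [cite: BalabanImbrieJaffe1988, (5.14.2) p.308] -/
theorem pin_mem_asg (s₀ : S) (A : Finset α) (γ : α → S) : pin s₀ A γ ∈ asg s₀ A :=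
  mem_asg.2 fun j hj => by simp [pin, hj]

/-- **Product structure of the assignments over two disjoint label sets.** For `A ∩ C = ∅`, `u` depending only on the labels in `A` and
`w` only on those in `C`: `Σ_{γ ∈ asg(A ∪ C)} u(γ) w(γ) = (Σ_{γ ∈ asg A} u(γ)) · (Σ_{γ ∈ asg C} w(γ))`.
[cite: BalabanImbrieJaffe1988, (5.14.2) p.308] -/
theorem sum_asg_union_mul {s₀ : S} {A C : Finset α} (hAC : Disjoint A C) {u w : (α → S) → R}
    (hu : ∀ γ γ', (∀ j ∈ A, γ j = γ' j) → u γ = u γ') (hw : ∀ γ γ', (∀ j ∈ C, γ j = γ' j) → w γ = w γ') :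
    ∑ γ ∈ asg s₀ (A ∪ C), u γ * w γ = (∑ γ ∈ asg s₀ A, u γ) * ∑ γ ∈ asg s₀ C, w γ := by
  rw [sum_mul_sum, ← sum_product']
  refine sum_nbij' (fun γ => (pin s₀ A γ, pin s₀ C γ)) (fun q => fun j => if j ∈ A then q.1 j else q.2 j) ?_ ?_ ?_ ?_ ?_
  · intro γ _
    exact mem_product.2 ⟨pin_mem_asg s₀ A γ, pin_mem_asg s₀ C γ⟩
  · rintro ⟨γ₁, γ₂⟩ hq
    obtain ⟨h₁, h₂⟩ := mem_product.1 hq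
    refine mem_asg.2 fun j hj => ?_
    rw [mem_union, not_or] at hj
    simp only [hj.1, if_false]
    exact mem_asg.1 h₂ j hj.2
  · intro γ hγ
    funext j
    by_cases hjA : j ∈ A
    · simp [pin, hjA]
    · by_cases hjC : j ∈ C
      · simp [pin, hjA, hjC]
      · simp only [pin, hjA, hjC, if_false]
        exact (mem_asg.1 hγ j (by rw [mem_union, not_or]; exact ⟨hjA, hjC⟩)).symm
  · rintro ⟨γ₁, γ₂⟩ hq
    obtain ⟨h₁, h₂⟩ := mem_product.1 hq
    refine Prod.ext (funext fun j => ?_) (funext fun j => ?_)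
    · by_cases hjA : j ∈ A
      · simp [pin, hjA]
      · simp only [pin, hjA, if_false]
        exact (mem_asg.1 h₁ j hjA).symm
    · by_cases hjC : j ∈ C
      · have hjA : j ∉ A := fun h => disjoint_left.1 hAC h hjC
        simp [pin, hjA, hjC]
      · simp only [pin, hjC, if_false]
        exact (mem_asg.1 h₂ j hjC).symm
  · intro γ _
    dsimp only
    rw [hu γ (pin s₀ A γ) fun j hj => (pin_apply_of_mem hj).symm, hw γ (pin s₀ C γ) fun j hj => (pin_apply_of_mem hj).symm]

/-- **Factorization over the blocks of a set partition** (*"We cluster expand … each integral making up the truncated expectation values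
⟨(d/dt)_{γ_1}; …; (d/dt)_{γ_{n̄+1}}⟩_t"* — the sum over assignments of a product of block-local factors is the product of the block
sums): for `π` a set partition of `K` and `g(B, ·)` depending only on the labels in `B`,
`Σ_{γ ∈ asg K} Π_{B∈π} g(B,γ) = Π_{B∈π} Σ_{γ ∈ asg B} g(B,γ)`. [cite: BalabanImbrieJaffe1988, (5.14.2) p.308; p.310 display 2] -/
theorem sum_asg_prod_eq_prod_sum {s₀ : S} {K : Finset α} {π : Finset (Finset α)} (hπ : IsSetPartition K π)
    {g : Finset α → (α → S) → R} (hg : ∀ B ∈ π, ∀ γ γ', (∀ j ∈ B, γ j = γ' j) → g B γ = g B γ') :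
    ∑ γ ∈ asg s₀ K, ∏ B ∈ π, g B γ = ∏ B ∈ π, ∑ γ ∈ asg s₀ B, g B γ := by
  induction π using Finset.induction_on generalizing K with
  | empty =>
    have hK : K = ∅ := by
      rw [eq_empty_iff_forall_notMem]
      intro v hv
      obtain ⟨P, hP, -⟩ := hπ.exists_mem hv
      exact notMem_empty P hP
    subst hK
    simp [asg_empty]
  | insert B₀ π' hB₀ ih =>
    have hB₀K : B₀ ⊆ K := hπ.subset (mem_insert_self _ _)
    have hπ' : IsSetPartition (K \ B₀) π' := by
      have h := hπ.erase (mem_insert_self B₀ π')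
      rwa [erase_insert hB₀] at h
    have hK : K = B₀ ∪ (K \ B₀) := (union_sdiff_of_subset hB₀K).symm
    rw [prod_insert hB₀, hK, sum_congr rfl fun γ _ => prod_insert hB₀]
    rw [sum_asg_union_mul disjoint_sdiff (hg B₀ (mem_insert_self _ _)) ?_, ih hπ' fun B hB => hg B (mem_insert_of_mem hB)]
    · -- locality of the product of the remaining block factors on `K \ B₀`
      intro γ γ' hγ
      refine prod_congr rfl fun B hB => hg B (mem_insert_of_mem hB) γ γ' fun j hj => hγ j (hπ'.subset hB hj)

/-- **The assignment-summed truncated expectations solve display 2 for the summed moments.** Slot moments `N(K,γ)` (local in the labels of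
`K`) and their truncated functions `κ(B,γ)` (local, solving display 2 for each assignment `γ`): then `M(K) := Σ_{γ ∈ asg K} N(K,γ)` and
`𝒦(B) := Σ_{γ ∈ asg B} κ(B,γ)` again satisfy `M(K) = Σ_{π∈𝒫(K)} Π_{B∈π} 𝒦(B)` (*"We express each d/dt as a sum Σ_γ (d/dt)_γ"*: multilinearity).
[cite: BalabanImbrieJaffe1988, (5.14.2) p.308; p.310 display 2] -/
theorem sum_asg_trunc_rel {s₀ : S} {V : Finset α} {N κ : Finset α → (α → S) → R}
    (hκloc : ∀ B γ γ', (∀ j ∈ B, γ j = γ' j) → κ B γ = κ B γ')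
    (hrel : ∀ γ, ∀ K ⊆ V, K.Nonempty → N K γ = ∑ π ∈ setPartitions K, ∏ B ∈ π, κ B γ) :
    ∀ K ⊆ V, K.Nonempty →
      ∑ γ ∈ asg s₀ K, N K γ = ∑ π ∈ setPartitions K, ∏ B ∈ π, ∑ γ ∈ asg s₀ B, κ B γ := by
  intro K hKV hK
  rw [sum_congr rfl fun γ _ => hrel γ K hKV hK, sum_comm]
  exact sum_congr rfl fun π hπ => sum_asg_prod_eq_prod_sum (mem_setPartitions.1 hπ) fun B _ => hκloc B

/-- **`Σ_γ ⟨(d/dt)_{γ_1}; …; (d/dt)_{γ_n}⟩_t = (d/dt)ⁿ log z_t`.** If the slot moments sum, over all assignments of the labels of `K`,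
to the derivative moments `⟨(d/dt)^{|K|}⟩_t = z^{(|K|)}(t)/z(t)` (Leibniz: *"We express each d/dt as a sum Σ_γ (d/dt)_γ"*) and `κ(·,γ)` are
their slot-local display-2 truncations, then the assignment sum of the truncated expectations of the labels of `K` is `(log z)^{(|K|)}(t)`
(`z > 0` of class `Cⁿ` within `s ∋ t`, `|V| ≤ n`). [cite: BalabanImbrieJaffe1988, (5.14.2) p.308; p.310 display 2] -/
theorem sum_asg_trunc_eq_iteratedDerivWithin_log {s : Set ℝ} (hs : UniqueDiffOn ℝ s) {t : ℝ} (ht : t ∈ s) {z : ℝ → ℝ} {n : ℕ}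
    (hz : ContDiffOn ℝ n z s) (hpos : ∀ x ∈ s, 0 < z x) {V : Finset α} (hV : V.card ≤ n) {s₀ : S}
    {N κ : Finset α → (α → S) → ℝ} (hκloc : ∀ B γ γ', (∀ j ∈ B, γ j = γ' j) → κ B γ = κ B γ')
    (hrel : ∀ γ, ∀ K ⊆ V, K.Nonempty → N K γ = ∑ π ∈ setPartitions K, ∏ B ∈ π, κ B γ)
    (hN : ∀ K ⊆ V, K.Nonempty → ∑ γ ∈ asg s₀ K, N K γ = iteratedDerivWithin K.card z s t / z t) :
    ∀ K ⊆ V, K.Nonempty → ∑ γ ∈ asg s₀ K, κ K γ = iteratedDerivWithin K.card (fun x => Real.log (z x)) s t := by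
  refine trunc_eq_iteratedDerivWithin_log hs ht hz hpos hV (κ := fun B => ∑ γ ∈ asg s₀ B, κ B γ) fun K hKV hK => ?_
  rw [← hN K hKV hK]
  exact sum_asg_trunc_rel hκloc hrel K hKV hK

/-- The top label set `H = univ` (all `n` derivative labels, all assignments): `Σ_{γ : H → slots} ⟨(d/dt)_{γ_1}; …; (d/dt)_{γ_n}⟩_t = (d/dt)ⁿ log z_t`.
[cite: BalabanImbrieJaffe1988, (5.14.2) p.308; p.310 display 2] -/
theorem sum_trunc_univ_eq_iteratedDerivWithin_log {s : Set ℝ} (hs : UniqueDiffOn ℝ s) {t : ℝ} (ht : t ∈ s) {z : ℝ → ℝ} {n : ℕ}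
    (hz : ContDiffOn ℝ n z s) (hpos : ∀ x ∈ s, 0 < z x) (hH : Fintype.card α = n) (hn : 0 < n) (s₀ : S)
    {N κ : Finset α → (α → S) → ℝ} (hκloc : ∀ B γ γ', (∀ j ∈ B, γ j = γ' j) → κ B γ = κ B γ')
    (hrel : ∀ γ, ∀ K : Finset α, K.Nonempty → N K γ = ∑ π ∈ setPartitions K, ∏ B ∈ π, κ B γ)
    (hN : ∀ K : Finset α, K.Nonempty → ∑ γ ∈ asg s₀ K, N K γ = iteratedDerivWithin K.card z s t / z t) :
    ∑ γ : α → S, κ univ γ = iteratedDerivWithin n (fun x => Real.log (z x)) s t := by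
  have h := sum_asg_trunc_eq_iteratedDerivWithin_log hs ht hz hpos (V := univ) (by rw [card_univ, hH]) (s₀ := s₀) hκloc
    (fun γ K _ hK => hrel γ K hK) (fun K _ hK => hN K hK) univ Subset.rfl
    (univ_nonempty_iff.2 (Fintype.card_pos_iff.1 (hH ▸ hn)))
  rwa [asg_univ, card_univ, hH] at h

/-- **(5.14.2) for the assignment-summed truncated expectation on `[0,1]`** (labels `H`, `|H| = n̄+1`; r16's `remR` BY NAME): with
`⟨d/dt;…;d/dt⟩_t := Σ_γ ⟨(d/dt)_{γ_1}; …; (d/dt)_{γ_{n̄+1}}⟩_t` (slot-local display-2 truncations of slot moments summing to `z_t^{(j)}/z_t`),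
`ℛ_k^{printed} = −(1/(n̄+1)) ∫₀¹ ((1−t)^{n̄}/n̄!) (d/dt)^{n̄+1} log z_t dt` — the sibling file's `remR_trunc_eq` for the summed truncation.
[cite: BalabanImbrieJaffe1988, (5.14.2) p.308; p.310 display 2] -/
theorem remR_sum_trunc_eq {nbar : ℕ} (hH : Fintype.card α = nbar + 1) (s₀ : S) {z : ℝ → ℝ}
    (hz : ContDiffOn ℝ (nbar + 1 : ℕ) z (Set.uIcc 0 1)) (hpos : ∀ t ∈ Set.uIcc (0 : ℝ) 1, 0 < z t)
    {N κ : ℝ → Finset α → (α → S) → ℝ} (hκloc : ∀ t B γ γ', (∀ j ∈ B, γ j = γ' j) → κ t B γ = κ t B γ')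
    (hrel : ∀ t ∈ Set.uIcc (0 : ℝ) 1, ∀ γ, ∀ K : Finset α, K.Nonempty → N t K γ = ∑ π ∈ setPartitions K, ∏ B ∈ π, κ t B γ)
    (hN : ∀ t ∈ Set.uIcc (0 : ℝ) 1, ∀ K : Finset α, K.Nonempty →
      ∑ γ ∈ asg s₀ K, N t K γ = iteratedDerivWithin K.card z (Set.uIcc 0 1) t / z t) :
    remR (fun t => ∑ γ : α → S, κ t univ γ) nbar = -(1 / (nbar + 1 : ℝ)) *
      ∫ t in (0 : ℝ)..1, ((1 - t) ^ nbar / nbar.factorial) *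
        iteratedDerivWithin (nbar + 1) (fun x => Real.log (z x)) (Set.uIcc 0 1) t := by
  have h := remR_trunc_eq (ι := α) hH hz hpos (κ := fun t K => ∑ γ ∈ asg s₀ K, κ t K γ) fun t ht K hK => by
    rw [← hN t ht K hK]
    exact sum_asg_trunc_rel (V := univ) (hκloc t) (fun γ K _ hK' => hrel t ht γ K hK') K (subset_univ K) hK
  simpa only [asg_univ] using h

end Slots

end Literature.MathematicalPhysics.QuantumFieldTheory.BalabanImbrieJaffe1984to88.BIJ88TruncatedExpectation5142
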